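import Summits.BirchSwinnertonDyer.BirchSwinnertonDyer.Theorems.ByReductionTypeAtTwoOrdKatoHalfAtTwoIsoPosDiscSplit
import Summits.BirchSwinnertonDyer.BirchSwinnertonDyer.Theses.ByReductionTypeAtTwo
import HarnessLib

/-!
# CERT (lead g5) for the planner's package P8′ of crux 202 `OrdKatoHalfAtTwoIso` (stmt-BirchSwinnertonDyer-19573):
# the post-P8′ split glue closes BY NAME through the lead's door `ordKatoHalfAtTwoIso_of_iota_halves` (p695020)

Nothing is asserted; `example`s only. The texts: child 23959 ↦ `SteinbergFibreAtTwo.ZetaColemanMuIotaNegDiscAtTwo` (F1μι⁻), NEW child #5 :=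
`SteinbergFibreAtTwo.OrdKatoHalfAtTwoIsoPosDisc` (both displayed by p693557), bundle 23889 and B7′ 23921 unchanged, CoreA⁺ 23967 (CLOSED) kept
or dropped. Each `example` is the future `OrdKatoHalfAtTwoIsoOfChildren` text for one ordering, proved by the corresponding `first` branch of
the lead's OfChildren proposal. BSD is not proved by any of this; the crux stays conditional on its open children.
-/

set_option autoImplicit false
set_option linter.dupNamespace false

open Summit.BirchSwinnertonDyer.BirchSwinnertonDyer.Theses.ByReductionTypeAtTwo
open Summit.BirchSwinnertonDyer.BirchSwinnertonDyer.Theorems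

/-- P8′ glue text, ordering «bundle, F1μι⁻, B7′, CoreA⁺, PosDisc» (new child LAST, 23967 kept). -/
example : OrdKatoIsoPrintBundleAtTwo → SteinbergFibreAtTwo.ZetaColemanMuIotaNegDiscAtTwo → OrdKatoMuPartOptimalAtTwo →
    OrdKatoIntSurjectiveAtTwo → SteinbergFibreAtTwo.OrdKatoHalfAtTwoIsoPosDisc → OrdKatoHalfAtTwoIso :=
  fun hB hF1 hB7 _hB8 hPos => SteinbergFibreAtTwo.ordKatoHalfAtTwoIso_of_iota_halves hF1 hPos hB hB7

/-- P8′ glue text, ordering «bundle, F1μι⁻, B7′, PosDisc» (23967 dropped from the glue). -/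
example : OrdKatoIsoPrintBundleAtTwo → SteinbergFibreAtTwo.ZetaColemanMuIotaNegDiscAtTwo → OrdKatoMuPartOptimalAtTwo →
    SteinbergFibreAtTwo.OrdKatoHalfAtTwoIsoPosDisc → OrdKatoHalfAtTwoIso :=
  fun hB hF1 hB7 hPos => SteinbergFibreAtTwo.ordKatoHalfAtTwoIso_of_iota_halves hF1 hPos hB hB7

/-- P8′ glue text, ordering «bundle, F1μι⁻, B7′, PosDisc, CoreA⁺». -/
example : OrdKatoIsoPrintBundleAtTwo → SteinbergFibreAtTwo.ZetaColemanMuIotaNegDiscAtTwo → OrdKatoMuPartOptimalAtTwo →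
    SteinbergFibreAtTwo.OrdKatoHalfAtTwoIsoPosDisc → OrdKatoIntSurjectiveAtTwo → OrdKatoHalfAtTwoIso :=
  fun hB hF1 hB7 hPos _hB8 => SteinbergFibreAtTwo.ordKatoHalfAtTwoIso_of_iota_halves hF1 hPos hB hB7

/-- P8′ glue text, ordering «bundle, F1μι⁻, PosDisc, B7′, CoreA⁺». -/
example : OrdKatoIsoPrintBundleAtTwo → SteinbergFibreAtTwo.ZetaColemanMuIotaNegDiscAtTwo →
    SteinbergFibreAtTwo.OrdKatoHalfAtTwoIsoPosDisc → OrdKatoMuPartOptimalAtTwo → OrdKatoIntSurjectiveAtTwo → OrdKatoHalfAtTwoIso :=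
  fun hB hF1 hPos hB7 _hB8 => SteinbergFibreAtTwo.ordKatoHalfAtTwoIso_of_iota_halves hF1 hPos hB hB7

/-- TODAY's text (rev 39) still closes through the P7 door (sanity; the live branch). -/
example : OrdKatoHalfAtTwoIsoOfChildren :=
  fun hB hF1 hB7 hB8 => SteinbergFibreAtTwo.ordKatoHalfAtTwoIso_of_signFree_cite hF1 hB8 hB hB7

/-- **P8′ AS PACKAGED (pen RC-390 (2) / RC-392): PAIR IN THE F1 SLOT, glue statement unchanged** — state (bundle3, F1 := F1μι⁻ ∧ PosDisc,
B7′, core⁺): the lead's FIRST branch `fun hB hF1 hB7 hB8 => …of_iota_halves hF1.1 hF1.2 hB hB7` (by name of the two defs; the filed text is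
their bodies verbatim, `CertP8Glue.lean` has the `Iff.rfl`). -/
example : OrdKatoIsoPrintBundleAtTwo →
    (SteinbergFibreAtTwo.ZetaColemanMuIotaNegDiscAtTwo ∧ SteinbergFibreAtTwo.OrdKatoHalfAtTwoIsoPosDisc) →
    OrdKatoMuPartOptimalAtTwo → OrdKatoIntSurjectiveAtTwo → OrdKatoHalfAtTwoIso :=
  fun hB hF1 hB7 _hB8 => SteinbergFibreAtTwo.ordKatoHalfAtTwoIso_of_iota_halves hF1.1 hF1.2 hB hB7
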